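import Summits.QuantumFields.YangMills.Theorems.FluctuationComparisonRegPrIntLS2BetaWhitneyHatLiftCurvatureRelative
import Summits.QuantumFields.YangMills.Theorems.FluctuationComparisonRegPrIntLS2BetaWhitneyHatLiftCurvature
import Summits.QuantumFields.YangMills.Theorems.FluctuationComparisonRegPrIntLS2BetaWhitneyHatCurlSq
import Summits.QuantumFields.YangMills.Theorems.FluctuationComparisonRegPrIntLS2BetaKappaRatioTower
import Summits.QuantumFields.YangMills.Theorems.FluctuationComparisonRegPrIntLS2BetaLogChordComparison
import HarnessLib

/-!
# S2β · THE SUP CHAIN ∕ (D-stage): THE LIFT-CURVATURE COLUMN `ρA`, LOCAL EDITION — ONE child plaquette against the PARENT letters on its own stencil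
# (the cube column of the Whitney hat and the hat feeders of its four bonds): `dist1 (P_{A_W} q·(P_{A_U} q)⁻¹)² ≤ (L⁻¹)⁴·(4·ρP² + 1536·(2σ)²·((1+σ²∕3)·mC)²)`

Cell `ym3-torus` (rung R3 = continuum `SU(2)` Yang–Mills on T³ at fixed lattice data — NOT d = 4, NOT infinite volume, NOT a mass gap, NOT Clay).  Width seat «width 12»
`ym3-torus-px12` (gen 26), FREE px helper on crux `stmt-QuantumFields-20520`; `--supports` helper, count-neutral, DEFINITION-FREE (0 `def`∕`instance`∕`notation`∕`sorry`,
default heartbeats).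

WHY (px21 g25 22:55:32Z on ✓p836580 FILE R: «REGION-SUP (LOCAL) FORM, please — the global ℓ² sum is not consumable in the `S′` currency without an `L^{d·t}` loss … per
child plaquette `q`, the parent letters as sups over an EXPLICIT bounded parent stencil»).  THIS FILE is that local edition, in the established support-local style of
✓`…WhitneyHatLiftCurvature` (letters ON THE SUPPORT of the weights; the geometry of the supports is the lit lemmas' ✓`colW_support` ∕ ✓`hatW_support`: the cube-column
coarse plaquettes `y` of `q` have `0 ≤ rel (emb y) q.src μ,ν < L` and `|rel (emb y) q.src ι| < L` transversally; the feeders `e` of a bond `b` have `e.dir = b.dir` and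
`|rel (emb e.src) b.src ν| < L`).  §1 (one level, generic `P`): g23 ✓`dist1_rect_rel_lift_sq_le` (per position: `2‖dδ‖² + 128L⁻²(s+s̃)²Σ₄‖δ_b‖²`) + ✓`sq_norm_lincurl_hat_le`
(Jensen over the cube column, `Σ_y W = 1`) ∘ ✓`sq_norm_lincurl_rel_coarse_le` (per coarse plaquette) for `‖dδ‖² ≤ L⁻⁴(2ρ² + 512(s+s̃)²m²)`, and ✓`norm_hatSum_le_of_support`
for `‖δ_b‖ ≤ L⁻¹·m`: `dist1(E_q)² ≤ (L⁻¹)²(L⁻¹)²·(4ρ² + 1536(s+s̃)²m²)` with `ρ` = sup of the coarse RELATIVE plaquettes on the column, `m` = sup of the coarse log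
differences on the column's and the feeders' bonds.  §2 (tower, TEXT currency, as ✓p836580): child height `s = K−(J+(t+1))`, `A_W = lift s (g_{s+1} • Ū^{s+1}(e^ζU₀))`,
`A_U = lift s (g₀_{s+1} • Ū^{s+1}U₁)`; common gauge of the parent pair (px16 ✓`stage_eq_gaugeAct_iter`), parent relative plaquettes in px10's (DOM) currency
(✓`rect_one_one`, ✓`dist1_relPlaq_gaugeAct`), log differences `≤ (1+σ²∕3)·dist1` of the RAW relative chords ((L♭) ✓`norm_logVec_sub_le_mul_dist1`, ✓`dist1_gaugeAct_chord'`),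
child side flipped to FILE P's orientation.

WHAT IS PROVED (sorry-free).  ★★`dist1_rect_rel_lift_sq_le_local` (generic level), ★★★`dist1_relLift_sq_le_local_tower` (the ρA column per child plaquette:
`dist1 (P_{A_W} q * (P_{A_U} q)⁻¹)² ≤ (L⁻¹)²·(L⁻¹)²·(4·ρP² + 1536·(σ+σ)²·((1+σ²∕3)·mC)²)`).

HONEST SCOPE.  Bookkeeping over landed lemmas; arcs, (T3), the bottom relation, hat weights∕lift formula and the stencil letters are HYPOTHESES; nothing of Bałaban's
renormalisation-group analysis is asserted or proved ([Balaban1985Variational] (34) p.283; [Balaban1985RegularSpaces] (1.29) p.81; [Balaban1985Averaging] (8)–(9) p.19).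
The (α) assembler's parent cover (k2′), budgets, the knit, GAP♯∘ (`stub_uniformFibreGapOrbit`, registry 3732b7df UNTOUCHED), the five registered stubs (0∕5), S2β, 20520,
19936, 19200, `YM3TorusSU2` are NOT proved; no registered stub is closed; rung R3 — NOT d = 4, NOT infinite volume, NOT a mass gap, NOT Clay; the Yang–Mills mass gap
is NOT proved.
-/

set_option autoImplicit false

noncomputable section

namespace Summit.QuantumFields.YangMills.Theorems.FluctuationComparisonRegPrIntLS2BetaLiftCurvatureLocalTower

open Finset
open scoped Real
open Literature.MathematicalPhysics.QuantumLattice (su2Quat)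
open Literature.MathematicalPhysics.QuantumFieldTheory.Balaban1983to89
open T4Continuum T3ContinuumYM3Torus T3TiltDescent T3LevelShift BlockAveraging
open B10Eq27TorusAxialLog (rel axialT)
open B10Eq47AxialChi (rect rect_one_one)
open T4CubeChartGnomonic (SU2)
open T4HaarSU2ExpChart (expPoint)
open T4ExpWindowSmallField (logVec)
open T3UnitLawDensityEML (ℰp)
open B11GaugeGlue (dist1_inv_mul_eq)
open Summit.QuantumFields.YangMills.Theorems.FluctuationComparisonRegPrIntLS2BetaWhitneyHatLiftCurvatureRelative (dist1_rect_rel_lift_sq_le sq_norm_lincurl_rel_coarse_le)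
open Summit.QuantumFields.YangMills.Theorems.FluctuationComparisonRegPrIntLS2BetaWhitneyHatLiftCurvature (norm_hatSum_le_of_support)
open Summit.QuantumFields.YangMills.Theorems.FluctuationComparisonRegPrIntLS2BetaWhitneyHatCurl (sum_colW_eq_one colW_nonneg)
open Summit.QuantumFields.YangMills.Theorems.FluctuationComparisonRegPrIntLS2BetaWhitneyHatCurlSq (sq_norm_lincurl_hat_le)
open Summit.QuantumFields.YangMills.Theorems.FluctuationComparisonRegPrIntLS2BetaKappaRatioTower (stage_eq_gaugeAct_iter)
open Summit.QuantumFields.YangMills.Theorems.FluctuationComparisonRegPrIntLS2BetaRelativeGaugeCovariance (dist1_relPlaq_gaugeAct dist1_gaugeAct_chord')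
open Summit.QuantumFields.YangMills.Theorems.FluctuationComparisonRegPrIntLS2BetaLogChordComparison (norm_logVec_sub_le_mul_dist1)

/-! ## §1 One level, generic `P`: the relative curvature of two hat lifts at ONE position against support-local parent letters -/

section Local

variable {P : Params} {t : ℕ}

/-- ★★ **THE RELATIVE LIFT CURVATURE AT ONE POSITION, LOCAL LETTERS**: for two coarse fields `X, X̃` with arcs `≤ s, s̃ ≤ ¼`, their hat lifts `V, Ṽ`, a position
`(x; μ ≠ κ)`, and numbers `ρ`, `m` bounding the coarse RELATIVE plaquettes `dist1((R_{μκ}X̃(y))⁻¹·R_{μκ}X(y))` on the cube column of `x` (`W(x,y) ≠ 0`) and the coarse log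
differences `‖log X e − log X̃ e‖` on the bonds of those plaquettes and on the hat feeders of the four fine bonds (`w b e ≠ 0`):
`dist1((R_{μκ}Ṽ(x))⁻¹·R_{μκ}V(x))² ≤ (L⁻¹)²·(L⁻¹)²·(4ρ² + 1536(s+s̃)²m²)`. [cite: Balaban1985Variational, (34) p.283; Balaban1985RegularSpaces, (1.29) p.81] -/
theorem dist1_rect_rel_lift_sq_le_local (ht : t + 1 ≤ P.m + P.K) (w : PBond P t → PBond P (t + 1) → ℝ)
    (hw : ∀ b e, w b e = if e.dir = b.dir ∧ (b.src b.dir - emb e.src b.dir).val < P.L then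
      ∏ ν ∈ Finset.univ.erase b.dir, max 0 (1 - ((rel (emb e.src) b.src ν).natAbs : ℝ) / P.L) else 0)
    (X X' : GaugeField P (t + 1) SU2) (V V' : GaugeField P t SU2)
    (hV : ∀ b, V b = expPoint (∑ e, w b e • ((P.L : ℝ)⁻¹ • logVec (su2Quat (X e)))))
    (hV' : ∀ b, V' b = expPoint (∑ e, w b e • ((P.L : ℝ)⁻¹ • logVec (su2Quat (X' e)))))
    {s s' : ℝ} (hs : ∀ e, ‖logVec (su2Quat (X e))‖ ≤ s) (hs' : ∀ e, ‖logVec (su2Quat (X' e))‖ ≤ s') (hs4 : s ≤ 1 / 4) (hs4' : s' ≤ 1 / 4)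
    (x : Site P t) {μ κ : Fin P.d} (hμκ : μ ≠ κ) {ρ m : ℝ}
    (hρ : ∀ y : Site P (t + 1), (if (x μ - emb y μ).val < P.L then (1 : ℝ) else 0) *
          (∏ ι ∈ (Finset.univ.erase μ).erase κ, max 0 (1 - ((rel (emb y) x ι).natAbs : ℝ) / P.L)) *
          (if (x κ - emb y κ).val < P.L then (1 : ℝ) else 0) ≠ 0 →
      dist1 ((rect X' y μ κ 1 1)⁻¹ * rect X y μ κ 1 1) ≤ ρ)
    (hmcol : ∀ y : Site P (t + 1), (if (x μ - emb y μ).val < P.L then (1 : ℝ) else 0) *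
          (∏ ι ∈ (Finset.univ.erase μ).erase κ, max 0 (1 - ((rel (emb y) x ι).natAbs : ℝ) / P.L)) *
          (if (x κ - emb y κ).val < P.L then (1 : ℝ) else 0) ≠ 0 →
      ∀ e : PBond P (t + 1), (e = ⟨y, μ⟩ ∨ e = ⟨y.shift μ, κ⟩ ∨ e = ⟨y.shift κ, μ⟩ ∨ e = ⟨y, κ⟩) → ‖logVec (su2Quat (X e)) - logVec (su2Quat (X' e))‖ ≤ m)
    (hmfeed : ∀ b : PBond P t, (b = ⟨x, μ⟩ ∨ b = ⟨x.shift μ, κ⟩ ∨ b = ⟨x.shift κ, μ⟩ ∨ b = ⟨x, κ⟩) → ∀ e : PBond P (t + 1), w b e ≠ 0 → ‖logVec (su2Quat (X e)) - logVec (su2Quat (X' e))‖ ≤ m) :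
    dist1 ((rect V' x μ κ 1 1)⁻¹ * rect V x μ κ 1 1) ^ 2 ≤
      ((P.L : ℝ)⁻¹) ^ 2 * ((P.L : ℝ)⁻¹) ^ 2 * (4 * ρ ^ 2 + 1536 * (s + s') ^ 2 * m ^ 2) := by
  have h0 := dist1_rect_rel_lift_sq_le ht w hw X X' V V' hV hV' hs hs' hs4 hs4' x μ κ
  -- the fine difference field `δ` and the coarse form `A = L⁻¹ • Δ`
  set δ : PBond P t → EuclideanSpace ℝ (Fin 3) := fun b => ∑ e, w b e • ((P.L : ℝ)⁻¹ • (logVec (su2Quat (X e)) - logVec (su2Quat (X' e)))) with hδ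
  set A : PBond P (t + 1) → EuclideanSpace ℝ (Fin 3) := fun e => (P.L : ℝ)⁻¹ • (logVec (su2Quat (X e)) - logVec (su2Quat (X' e))) with hA
  have hLi : 0 ≤ (P.L : ℝ)⁻¹ := inv_nonneg.mpr (Nat.cast_nonneg _)
  have hss0 : 0 ≤ (s + s') ^ 2 := sq_nonneg _
  -- ρ ≥ 0 on a non-empty column (the column weights sum to one)
  have hcurl := sq_norm_lincurl_hat_le ht w hw A δ (fun _ => rfl) x hμκ
  have hsum := sum_colW_eq_one ht x hμκ
  -- the coarse curls on the column: `≤ L⁻²(2ρ² + 512(s+s̃)²m²)` wherever the weight is non-zero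
  have hB : ∑ y : Site P (t + 1), ((if (x μ - emb y μ).val < P.L then (1 : ℝ) else 0) *
          (∏ ι ∈ (Finset.univ.erase μ).erase κ, max 0 (1 - ((rel (emb y) x ι).natAbs : ℝ) / P.L)) *
          (if (x κ - emb y κ).val < P.L then (1 : ℝ) else 0)) *
        ‖A ⟨y, μ⟩ + A ⟨y.shift μ, κ⟩ - A ⟨y.shift κ, μ⟩ - A ⟨y, κ⟩‖ ^ 2 ≤
      ((P.L : ℝ)⁻¹) ^ 2 * (2 * ρ ^ 2 + 512 * (s + s') ^ 2 * m ^ 2) := by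
    calc ∑ y : Site P (t + 1), ((if (x μ - emb y μ).val < P.L then (1 : ℝ) else 0) *
          (∏ ι ∈ (Finset.univ.erase μ).erase κ, max 0 (1 - ((rel (emb y) x ι).natAbs : ℝ) / P.L)) *
          (if (x κ - emb y κ).val < P.L then (1 : ℝ) else 0)) *
          ‖A ⟨y, μ⟩ + A ⟨y.shift μ, κ⟩ - A ⟨y.shift κ, μ⟩ - A ⟨y, κ⟩‖ ^ 2
        ≤ ∑ y : Site P (t + 1), ((if (x μ - emb y μ).val < P.L then (1 : ℝ) else 0) *
          (∏ ι ∈ (Finset.univ.erase μ).erase κ, max 0 (1 - ((rel (emb y) x ι).natAbs : ℝ) / P.L)) *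
          (if (x κ - emb y κ).val < P.L then (1 : ℝ) else 0)) *
          (((P.L : ℝ)⁻¹) ^ 2 * (2 * ρ ^ 2 + 512 * (s + s') ^ 2 * m ^ 2)) := by
          refine Finset.sum_le_sum fun y _ => ?_
          by_cases hW : (if (x μ - emb y μ).val < P.L then (1 : ℝ) else 0) *
          (∏ ι ∈ (Finset.univ.erase μ).erase κ, max 0 (1 - ((rel (emb y) x ι).natAbs : ℝ) / P.L)) *
          (if (x κ - emb y κ).val < P.L then (1 : ℝ) else 0) = 0
          · rw [hW, zero_mul, zero_mul]
          · refine mul_le_mul_of_nonneg_left ?_ (colW_nonneg x μ κ y)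
            have h2 := sq_norm_lincurl_rel_coarse_le X X' hs hs' hs4 hs4' y μ κ
            have hd : dist1 ((rect X' y μ κ 1 1)⁻¹ * rect X y μ κ 1 1) ^ 2 ≤ ρ ^ 2 :=
              pow_le_pow_left₀ (GaugeGroup.dist1_nonneg _) (hρ y hW) 2
            have hm1 : ‖logVec (su2Quat (X ⟨y, μ⟩)) - logVec (su2Quat (X' ⟨y, μ⟩))‖ ^ 2 ≤ m ^ 2 :=
              pow_le_pow_left₀ (norm_nonneg _) (hmcol y hW _ (Or.inl rfl)) 2
            have hm2 : ‖logVec (su2Quat (X ⟨y.shift μ, κ⟩)) - logVec (su2Quat (X' ⟨y.shift μ, κ⟩))‖ ^ 2 ≤ m ^ 2 :=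
              pow_le_pow_left₀ (norm_nonneg _) (hmcol y hW _ (Or.inr (Or.inl rfl))) 2
            have hm3 : ‖logVec (su2Quat (X ⟨y.shift κ, μ⟩)) - logVec (su2Quat (X' ⟨y.shift κ, μ⟩))‖ ^ 2 ≤ m ^ 2 :=
              pow_le_pow_left₀ (norm_nonneg _) (hmcol y hW _ (Or.inr (Or.inr (Or.inl rfl)))) 2
            have hm4 : ‖logVec (su2Quat (X ⟨y, κ⟩)) - logVec (su2Quat (X' ⟨y, κ⟩))‖ ^ 2 ≤ m ^ 2 :=
              pow_le_pow_left₀ (norm_nonneg _) (hmcol y hW _ (Or.inr (Or.inr (Or.inr rfl)))) 2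
            have hin : 2 * dist1 ((rect X' y μ κ 1 1)⁻¹ * rect X y μ κ 1 1) ^ 2 + 128 * (s + s') ^ 2 *
                (‖logVec (su2Quat (X ⟨y, μ⟩)) - logVec (su2Quat (X' ⟨y, μ⟩))‖ ^ 2
                  + ‖logVec (su2Quat (X ⟨y.shift μ, κ⟩)) - logVec (su2Quat (X' ⟨y.shift μ, κ⟩))‖ ^ 2
                  + ‖logVec (su2Quat (X ⟨y.shift κ, μ⟩)) - logVec (su2Quat (X' ⟨y.shift κ, μ⟩))‖ ^ 2
                  + ‖logVec (su2Quat (X ⟨y, κ⟩)) - logVec (su2Quat (X' ⟨y, κ⟩))‖ ^ 2) ≤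
                2 * ρ ^ 2 + 512 * (s + s') ^ 2 * m ^ 2 := by
              have h4 := mul_le_mul_of_nonneg_left (add_le_add (add_le_add (add_le_add hm1 hm2) hm3) hm4) (mul_nonneg (by norm_num : (0:ℝ) ≤ 128) hss0)
              linarith only [hd, h4]
            exact h2.trans (mul_le_mul_of_nonneg_left hin (pow_nonneg hLi 2))
      _ = ((P.L : ℝ)⁻¹) ^ 2 * (2 * ρ ^ 2 + 512 * (s + s') ^ 2 * m ^ 2) := by rw [← Finset.sum_mul, hsum, one_mul]
  have hcurl' : ‖δ ⟨x, μ⟩ + δ ⟨x.shift μ, κ⟩ - δ ⟨x.shift κ, μ⟩ - δ ⟨x, κ⟩‖ ^ 2 ≤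
      ((P.L : ℝ)⁻¹) ^ 2 * (((P.L : ℝ)⁻¹) ^ 2 * (2 * ρ ^ 2 + 512 * (s + s') ^ 2 * m ^ 2)) :=
    hcurl.trans (mul_le_mul_of_nonneg_left hB (pow_nonneg hLi 2))
  -- the four lifted differences: convex combinations of `L⁻¹·Δ` on the feeders
  have hδb : ∀ b : PBond P t, (b = ⟨x, μ⟩ ∨ b = ⟨x.shift μ, κ⟩ ∨ b = ⟨x.shift κ, μ⟩ ∨ b = ⟨x, κ⟩) → ‖δ b‖ ^ 2 ≤ ((P.L : ℝ)⁻¹ * m) ^ 2 := by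
    intro b hb
    refine pow_le_pow_left₀ (norm_nonneg _) (norm_hatSum_le_of_support ht w hw A b fun e he => ?_) 2
    rw [norm_smul, Real.norm_eq_abs, abs_of_nonneg hLi]
    exact mul_le_mul_of_nonneg_left (hmfeed b hb e he) hLi
  have h1 := hδb ⟨x, μ⟩ (Or.inl rfl)
  have h2 := hδb ⟨x.shift μ, κ⟩ (Or.inr (Or.inl rfl))
  have h3 := hδb ⟨x.shift κ, μ⟩ (Or.inr (Or.inr (Or.inl rfl)))
  have h4 := hδb ⟨x, κ⟩ (Or.inr (Or.inr (Or.inr rfl)))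
  have hsumδ := mul_le_mul_of_nonneg_left (add_le_add (add_le_add (add_le_add h1 h2) h3) h4)
    (mul_nonneg (mul_nonneg (by norm_num : (0:ℝ) ≤ 128) (pow_nonneg hLi 2)) hss0)
  calc dist1 ((rect V' x μ κ 1 1)⁻¹ * rect V x μ κ 1 1) ^ 2
      ≤ 2 * ‖δ ⟨x, μ⟩ + δ ⟨x.shift μ, κ⟩ - δ ⟨x.shift κ, μ⟩ - δ ⟨x, κ⟩‖ ^ 2 +
          128 * ((P.L : ℝ)⁻¹) ^ 2 * (s + s') ^ 2 * (‖δ ⟨x, μ⟩‖ ^ 2 + ‖δ ⟨x.shift μ, κ⟩‖ ^ 2 + ‖δ ⟨x.shift κ, μ⟩‖ ^ 2 + ‖δ ⟨x, κ⟩‖ ^ 2) := h0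
    _ ≤ 2 * (((P.L : ℝ)⁻¹) ^ 2 * (((P.L : ℝ)⁻¹) ^ 2 * (2 * ρ ^ 2 + 512 * (s + s') ^ 2 * m ^ 2))) +
          128 * ((P.L : ℝ)⁻¹) ^ 2 * (s + s') ^ 2 * (((P.L : ℝ)⁻¹ * m) ^ 2 + ((P.L : ℝ)⁻¹ * m) ^ 2 + ((P.L : ℝ)⁻¹ * m) ^ 2 + ((P.L : ℝ)⁻¹ * m) ^ 2) := by
        linarith only [hcurl', hsumδ]
    _ = ((P.L : ℝ)⁻¹) ^ 2 * ((P.L : ℝ)⁻¹) ^ 2 * (4 * ρ ^ 2 + 1536 * (s + s') ^ 2 * m ^ 2) := by ring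

end Local

/-! ## §2 The tower edition, TEXT currency: the ρA column of FILE P per child plaquette -/

/-- ★★★ **THE LIFT-CURVATURE COLUMN PER CHILD PLAQUETTE, AT THE TOWER, IN TEXT CURRENCY.**  Child height `s = K−(J+(t+1))`, parent `s+1 ≤ K−J`; hat lifts
`A_W = lift s (g_{s+1} • Ū^{s+1}(e^ζU₀))`, `A_U = lift s (g₀_{s+1} • Ū^{s+1}U₁)`; (T3)×2, the bottom relation; parent arcs `≤ σ ≤ ¼` (gauged towers); numbers `ρP`, `mC` with
`dist1((P_{Ū^{s+1}U₀} p)⁻¹·P_{Ū^{s+1}(e^ζU₀)} p) ≤ ρP` on the cube-column plaquettes `p = (y; q.μ, q.ν)` of `q` (`W(q.src, y) ≠ 0`) and `dist1(Ū^{s+1}(e^ζU₀) e·(Ū^{s+1}U₀ e)⁻¹) ≤ mC`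
on the bonds of those plaquettes and on the hat feeders of `q`'s four bonds (`wt s b e ≠ 0`):
`dist1 (P_{A_W} q·(P_{A_U} q)⁻¹)² ≤ (L⁻¹)²·(L⁻¹)²·(4·ρP² + 1536·(σ+σ)²·((1+σ²∕3)·mC)²)`. [cite: Balaban1985Variational, (34) p.283; Balaban1985RegularSpaces, (1.29) p.81; Balaban1985Averaging, (8)-(9) p.19] -/
theorem dist1_relLift_sq_le_local_tower
    {F : T3Family} {J K : ℕ} (U₀ : GaugeField (F.P K) 0 (Matrix.specialUnitaryGroup (Fin 2) ℂ)) (ζ : PBond (F.P K) 0 → EuclideanSpace ℝ (Fin 3))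
    (wt : (j : ℕ) → PBond (F.P K) j → PBond (F.P K) (j + 1) → ℝ)
    (lift : (j : ℕ) → GaugeField (F.P K) (j + 1) SU2 → GaugeField (F.P K) j SU2)
    (U₁ : GaugeField (F.P K) 0 SU2) (g g₀ : (j : ℕ) → Site (F.P K) j → SU2)
    (hwt : ∀ j b e, wt j b e = if e.dir = b.dir ∧ (b.src b.dir - emb e.src b.dir).val < (F.P K).L then
        ∏ ν ∈ Finset.univ.erase b.dir, max 0 (1 - ((rel (emb e.src) b.src ν).natAbs : ℝ) / (F.P K).L) else 0)
    (hlift : ∀ j X b, lift j X b = expPoint (∑ e, wt j b e • ((((F.P K).L : ℕ) : ℝ)⁻¹ • logVec (su2Quat (X e)))))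
    (hT3 : ∀ X : GaugeField (F.P K) 0 SU2, ∀ j, j ≤ K - J →
      Averaging.iter (fun k => blockAvg (P := F.P K) (j := k) ℰp) j (GaugeField.gaugeAct (g 0) X) =
        GaugeField.gaugeAct (g j) (Averaging.iter (fun k => blockAvg (P := F.P K) (j := k) ℰp) j X))
    (hT3' : ∀ X : GaugeField (F.P K) 0 SU2, ∀ j, j ≤ K - J →
      Averaging.iter (fun k => blockAvg (P := F.P K) (j := k) ℰp) j (GaugeField.gaugeAct (g₀ 0) X) =
        GaugeField.gaugeAct (g₀ j) (Averaging.iter (fun k => blockAvg (P := F.P K) (j := k) ℰp) j X))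
    (hU₀ : U₀ = GaugeField.gaugeAct (fun x => (g 0 x)⁻¹ * g₀ 0 x) U₁)
    (t : ℕ) (ht : t < K - J) {σ : ℝ} (hσ4 : σ ≤ 1 / 4)
    (hσ : ∀ e : PBond (F.P K) ((K - (J + (t + 1))) + 1), ‖logVec (su2Quat (GaugeField.gaugeAct (g ((K - (J + (t + 1))) + 1)) (Averaging.iter (fun k => blockAvg (P := F.P K) (j := k) ℰp) ((K - (J + (t + 1))) + 1) (fun ℓ => expPoint (ζ ℓ) * U₀ ℓ)) e))‖ ≤ σ)
    (hσ' : ∀ e : PBond (F.P K) ((K - (J + (t + 1))) + 1), ‖logVec (su2Quat (GaugeField.gaugeAct (g₀ ((K - (J + (t + 1))) + 1)) (Averaging.iter (fun k => blockAvg (P := F.P K) (j := k) ℰp) ((K - (J + (t + 1))) + 1) U₁) e))‖ ≤ σ)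
    (q : Plaq (F.P K) (K - (J + (t + 1)))) {ρP mC : ℝ}
    (hρP : ∀ y : Site (F.P K) ((K - (J + (t + 1))) + 1), (if (q.src q.μ - emb y q.μ).val < (F.P K).L then (1 : ℝ) else 0) *
          (∏ ι ∈ (Finset.univ.erase q.μ).erase q.ν, max 0 (1 - ((rel (emb y) q.src ι).natAbs : ℝ) / (F.P K).L)) *
          (if (q.src q.ν - emb y q.ν).val < (F.P K).L then (1 : ℝ) else 0) ≠ 0 →
      dist1 ((GaugeField.plaqHol (Averaging.iter (fun k => blockAvg (P := F.P K) (j := k) ℰp) ((K - (J + (t + 1))) + 1) U₀) ⟨y, q.μ, q.ν, q.hμν⟩)⁻¹ * GaugeField.plaqHol (Averaging.iter (fun k => blockAvg (P := F.P K) (j := k) ℰp) ((K - (J + (t + 1))) + 1) (fun ℓ => expPoint (ζ ℓ) * U₀ ℓ : GaugeField (F.P K) 0 (Matrix.specialUnitaryGroup (Fin 2) ℂ))) ⟨y, q.μ, q.ν, q.hμν⟩) ≤ ρP)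
    (hmCcol : ∀ y : Site (F.P K) ((K - (J + (t + 1))) + 1), (if (q.src q.μ - emb y q.μ).val < (F.P K).L then (1 : ℝ) else 0) *
          (∏ ι ∈ (Finset.univ.erase q.μ).erase q.ν, max 0 (1 - ((rel (emb y) q.src ι).natAbs : ℝ) / (F.P K).L)) *
          (if (q.src q.ν - emb y q.ν).val < (F.P K).L then (1 : ℝ) else 0) ≠ 0 →
      ∀ e : PBond (F.P K) ((K - (J + (t + 1))) + 1), (e = ⟨y, q.μ⟩ ∨ e = ⟨y.shift q.μ, q.ν⟩ ∨ e = ⟨y.shift q.ν, q.μ⟩ ∨ e = ⟨y, q.ν⟩) → dist1 ((Averaging.iter (fun k => blockAvg (P := F.P K) (j := k) ℰp) ((K - (J + (t + 1))) + 1) (fun ℓ => expPoint (ζ ℓ) * U₀ ℓ : GaugeField (F.P K) 0 (Matrix.specialUnitaryGroup (Fin 2) ℂ))) e * ((Averaging.iter (fun k => blockAvg (P := F.P K) (j := k) ℰp) ((K - (J + (t + 1))) + 1) U₀) e)⁻¹) ≤ mC)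
    (hmCfeed : ∀ b : PBond (F.P K) (K - (J + (t + 1))), (b = ⟨q.src, q.μ⟩ ∨ b = ⟨q.src.shift q.μ, q.ν⟩ ∨ b = ⟨q.src.shift q.ν, q.μ⟩ ∨ b = ⟨q.src, q.ν⟩) →
      ∀ e : PBond (F.P K) ((K - (J + (t + 1))) + 1), wt (K - (J + (t + 1))) b e ≠ 0 → dist1 ((Averaging.iter (fun k => blockAvg (P := F.P K) (j := k) ℰp) ((K - (J + (t + 1))) + 1) (fun ℓ => expPoint (ζ ℓ) * U₀ ℓ : GaugeField (F.P K) 0 (Matrix.specialUnitaryGroup (Fin 2) ℂ))) e * ((Averaging.iter (fun k => blockAvg (P := F.P K) (j := k) ℰp) ((K - (J + (t + 1))) + 1) U₀) e)⁻¹) ≤ mC) :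
    dist1 (GaugeField.plaqHol (lift (K - (J + (t + 1))) (GaugeField.gaugeAct (g ((K - (J + (t + 1))) + 1)) (Averaging.iter (fun k => blockAvg (P := F.P K) (j := k) ℰp) ((K - (J + (t + 1))) + 1) (fun ℓ => expPoint (ζ ℓ) * U₀ ℓ)))) q * (GaugeField.plaqHol (lift (K - (J + (t + 1))) (GaugeField.gaugeAct (g₀ ((K - (J + (t + 1))) + 1)) (Averaging.iter (fun k => blockAvg (P := F.P K) (j := k) ℰp) ((K - (J + (t + 1))) + 1) U₁))) q)⁻¹) ^ 2 ≤
      ((((F.P K).L : ℕ) : ℝ)⁻¹) ^ 2 * ((((F.P K).L : ℕ) : ℝ)⁻¹) ^ 2 * (4 * ρP ^ 2 + 1536 * (σ + σ) ^ 2 * ((1 + σ ^ 2 / 3) * mC) ^ 2) := by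
  have hsK : ((K - (J + (t + 1))) + 1) ≤ (F.P K).m + (F.P K).K := by show ((K - (J + (t + 1))) + 1) ≤ F.m + K; omega
  have hs1 : ((K - (J + (t + 1))) + 1) ≤ K - J := by omega
  have hstage : GaugeField.gaugeAct (g₀ ((K - (J + (t + 1))) + 1)) (Averaging.iter (fun k => blockAvg (P := F.P K) (j := k) ℰp) ((K - (J + (t + 1))) + 1) U₁) = GaugeField.gaugeAct (g ((K - (J + (t + 1))) + 1)) (Averaging.iter (fun k => blockAvg (P := F.P K) (j := k) ℰp) ((K - (J + (t + 1))) + 1) U₀) :=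
    stage_eq_gaugeAct_iter (fun k => blockAvg (P := F.P K) (j := k) ℰp) g g₀ U₁ U₀ (fun X => hT3 X ((K - (J + (t + 1))) + 1) hs1) (fun X => hT3' X ((K - (J + (t + 1))) + 1) hs1) hU₀
  have hσ0 : 0 ≤ σ := (norm_nonneg _).trans (hσ ⟨default, ⟨0, (F.P K).hd⟩⟩)
  have hσ3 : σ ^ 2 ≤ 3 := by nlinarith
  have hκ0 : 0 ≤ 1 + σ ^ 2 / 3 := by positivity
  -- (L♭) on one parent bond, common gauge: `‖log X e − log X′ e‖ ≤ (1+σ²∕3)·dist1(raw relative chord)`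
  have hLb : ∀ e : PBond (F.P K) ((K - (J + (t + 1))) + 1), dist1 ((Averaging.iter (fun k => blockAvg (P := F.P K) (j := k) ℰp) ((K - (J + (t + 1))) + 1) (fun ℓ => expPoint (ζ ℓ) * U₀ ℓ : GaugeField (F.P K) 0 (Matrix.specialUnitaryGroup (Fin 2) ℂ))) e * ((Averaging.iter (fun k => blockAvg (P := F.P K) (j := k) ℰp) ((K - (J + (t + 1))) + 1) U₀) e)⁻¹) ≤ mC →
      ‖logVec (su2Quat (GaugeField.gaugeAct (g ((K - (J + (t + 1))) + 1)) (Averaging.iter (fun k => blockAvg (P := F.P K) (j := k) ℰp) ((K - (J + (t + 1))) + 1) (fun ℓ => expPoint (ζ ℓ) * U₀ ℓ)) e)) - logVec (su2Quat (GaugeField.gaugeAct (g₀ ((K - (J + (t + 1))) + 1)) (Averaging.iter (fun k => blockAvg (P := F.P K) (j := k) ℰp) ((K - (J + (t + 1))) + 1) U₁) e))‖ ≤ (1 + σ ^ 2 / 3) * mC := by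
    intro e he
    have h1 := norm_logVec_sub_le_mul_dist1 (GaugeField.gaugeAct (g ((K - (J + (t + 1))) + 1)) (Averaging.iter (fun k => blockAvg (P := F.P K) (j := k) ℰp) ((K - (J + (t + 1))) + 1) (fun ℓ => expPoint (ζ ℓ) * U₀ ℓ)) e) (GaugeField.gaugeAct (g₀ ((K - (J + (t + 1))) + 1)) (Averaging.iter (fun k => blockAvg (P := F.P K) (j := k) ℰp) ((K - (J + (t + 1))) + 1) U₁) e) (hσ e) (hσ' e) hσ3
    have h2 : dist1 (GaugeField.gaugeAct (g ((K - (J + (t + 1))) + 1)) (Averaging.iter (fun k => blockAvg (P := F.P K) (j := k) ℰp) ((K - (J + (t + 1))) + 1) (fun ℓ => expPoint (ζ ℓ) * U₀ ℓ)) e * (GaugeField.gaugeAct (g₀ ((K - (J + (t + 1))) + 1)) (Averaging.iter (fun k => blockAvg (P := F.P K) (j := k) ℰp) ((K - (J + (t + 1))) + 1) U₁) e)⁻¹) = dist1 ((Averaging.iter (fun k => blockAvg (P := F.P K) (j := k) ℰp) ((K - (J + (t + 1))) + 1) (fun ℓ => expPoint (ζ ℓ) * U₀ ℓ : GaugeField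 (F.P K) 0 (Matrix.specialUnitaryGroup (Fin 2) ℂ))) e * ((Averaging.iter (fun k => blockAvg (P := F.P K) (j := k) ℰp) ((K - (J + (t + 1))) + 1) U₀) e)⁻¹) := by
      rw [hstage, dist1_gaugeAct_chord']
    rw [h2] at h1
    exact h1.trans (mul_le_mul_of_nonneg_left he hκ0)
  -- §1 at the tower
  have key := dist1_rect_rel_lift_sq_le_local (P := F.P K) (t := (K - (J + (t + 1)))) hsK (wt (K - (J + (t + 1)))) (hwt (K - (J + (t + 1))))
    (GaugeField.gaugeAct (g ((K - (J + (t + 1))) + 1)) (Averaging.iter (fun k => blockAvg (P := F.P K) (j := k) ℰp) ((K - (J + (t + 1))) + 1) (fun ℓ => expPoint (ζ ℓ) * U₀ ℓ))) (GaugeField.gaugeAct (g₀ ((K - (J + (t + 1))) + 1)) (Averaging.iter (fun k => blockAvg (P := F.P K) (j := k) ℰp) ((K - (J + (t + 1))) + 1) U₁)) (lift (K - (J + (t + 1))) (GaugeField.gaugeAct (g ((K - (J + (t + 1))) + 1)) (Averaging.iter (fun k => blockAvg (P := F.P K) (j := k) ℰp) ((K - (J + (t + 1))) + 1) (fun ℓ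 => expPoint (ζ ℓ) * U₀ ℓ)))) (lift (K - (J + (t + 1))) (GaugeField.gaugeAct (g₀ ((K - (J + (t + 1))) + 1)) (Averaging.iter (fun k => blockAvg (P := F.P K) (j := k) ℰp) ((K - (J + (t + 1))) + 1) U₁))) (fun b => hlift (K - (J + (t + 1))) _ b) (fun b => hlift (K - (J + (t + 1))) _ b) hσ hσ' hσ4 hσ4
    q.src q.hμν.ne (ρ := ρP) (m := (1 + σ ^ 2 / 3) * mC)
    (fun y hy => by
      rw [rect_one_one _ y q.hμν, rect_one_one _ y q.hμν, hstage, dist1_relPlaq_gaugeAct]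
      exact hρP y hy)
    (fun y hy e he => hLb e (hmCcol y hy e he))
    (fun b hb e he => hLb e (hmCfeed b hb e he))
  -- the child side in FILE P's orientation
  have hflip : dist1 ((rect (lift (K - (J + (t + 1))) (GaugeField.gaugeAct (g₀ ((K - (J + (t + 1))) + 1)) (Averaging.iter (fun k => blockAvg (P := F.P K) (j := k) ℰp) ((K - (J + (t + 1))) + 1) U₁))) q.src q.μ q.ν 1 1)⁻¹ * rect (lift (K - (J + (t + 1))) (GaugeField.gaugeAct (g ((K - (J + (t + 1))) + 1)) (Averaging.iter (fun k => blockAvg (P := F.P K) (j := k) ℰp) ((K - (J + (t + 1))) + 1) (fun ℓ => expPoint (ζ ℓ) * U₀ ℓ)))) q.src q.μ q.ν 1 1) =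
      dist1 (GaugeField.plaqHol (lift (K - (J + (t + 1))) (GaugeField.gaugeAct (g ((K - (J + (t + 1))) + 1)) (Averaging.iter (fun k => blockAvg (P := F.P K) (j := k) ℰp) ((K - (J + (t + 1))) + 1) (fun ℓ => expPoint (ζ ℓ) * U₀ ℓ)))) q * (GaugeField.plaqHol (lift (K - (J + (t + 1))) (GaugeField.gaugeAct (g₀ ((K - (J + (t + 1))) + 1)) (Averaging.iter (fun k => blockAvg (P := F.P K) (j := k) ℰp) ((K - (J + (t + 1))) + 1) U₁))) q)⁻¹) := by
    rw [rect_one_one _ q.src q.hμν, rect_one_one _ q.src q.hμν, dist1_inv_mul_eq,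
      show GaugeField.plaqHol (lift (K - (J + (t + 1))) (GaugeField.gaugeAct (g₀ ((K - (J + (t + 1))) + 1)) (Averaging.iter (fun k => blockAvg (P := F.P K) (j := k) ℰp) ((K - (J + (t + 1))) + 1) U₁))) ⟨q.src, q.μ, q.ν, q.hμν⟩ * (GaugeField.plaqHol (lift (K - (J + (t + 1))) (GaugeField.gaugeAct (g ((K - (J + (t + 1))) + 1)) (Averaging.iter (fun k => blockAvg (P := F.P K) (j := k) ℰp) ((K - (J + (t + 1))) + 1) (fun ℓ => expPoint (ζ ℓ) * U₀ ℓ)))) ⟨q.src, q.μ, q.ν, q.hμν⟩)⁻¹ =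
        (GaugeField.plaqHol (lift (K - (J + (t + 1))) (GaugeField.gaugeAct (g ((K - (J + (t + 1))) + 1)) (Averaging.iter (fun k => blockAvg (P := F.P K) (j := k) ℰp) ((K - (J + (t + 1))) + 1) (fun ℓ => expPoint (ζ ℓ) * U₀ ℓ)))) q * (GaugeField.plaqHol (lift (K - (J + (t + 1))) (GaugeField.gaugeAct (g₀ ((K - (J + (t + 1))) + 1)) (Averaging.iter (fun k => blockAvg (P := F.P K) (j := k) ℰp) ((K - (J + (t + 1))) + 1) U₁))) q)⁻¹)⁻¹ by rw [mul_inv_rev, inv_inv], GaugeGroup.dist1_inv]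
  rw [hflip] at key
  exact key

end Summit.QuantumFields.YangMills.Theorems.FluctuationComparisonRegPrIntLS2BetaLiftCurvatureLocalTower

end
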